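import Summits.Ventures.PackingBounds.ThreePointCert.CheckExact
import Summits.Ventures.PackingBounds.ThreePointCert.CheckFast

/-!
# Soundness of the exact three-point certificate checker, I: positive semidefinite face blocks

Framing: lottery ticket; floor = certified bounds/negative ranges. Venture `PackingBounds`
(cell `pub-packcert`), three-point SDP family.

Meaning of the face blocks of `ThreePointCert.CheckExact`: `Sent p i j` is the entry of
`S = cμ I + L Lᵀ + Δ`; if `psdOK p` holds then `S` pairs nonnegatively with every symmetric kernel `Φ`
that is positive semidefinite on `{0,…,f-1}` (`psd_pairing`) — the common source of `wᵀ S w ≥ 0`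
(the sums of squares of `(ii)`) and of the three-point positivity of a Gram-form block, with no
matrix square root.
-/

noncomputable section

open Finset
open scoped RealInnerProductSpace

namespace Summit.Ventures.PackingBounds.ThreePointCert

open Literature.Geometry.DiscreteGeometry Literature.Geometry.DiscreteGeometry.PolyCert
open Literature.Geometry.DiscreteGeometry.PolyCert.SPoly
open Literature.Analysis.SpecialFunctions

/-! ### The entries of `S` -/

/-- Decoded entry `(i, c)` of the factor `L` (zero outside the stored rows). -/
def PSDBlk.ell (p : PSDBlk) (i c : ℕ) : ℤ := (decRow p.B (getRowN p.L i)).getD c 0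

/-- `dotNZ` is `ThreePointCert.CheckFast.dotOffZ`. -/
theorem dotNZ_eq_dotOffZ : dotNZ = dotOffZ := rfl

/-- Unpacked `psdOK`. -/
theorem psdOK_spec (p : PSDBlk) (h : psdOK p = true) :
    p.BB = p.B * p.B ∧ (∀ r ∈ p.L, r.length ≤ p.f) ∧
      (∀ e ∈ p.delta, e.1 < p.f ∧ e.2.1 < p.f) ∧ deltaMass p.delta ≤ p.cmu := by
  unfold psdOK at h
  simp only [Bool.and_eq_true, beq_iff_eq, List.all_eq_true, decide_eq_true_eq] at h
  obtain ⟨⟨⟨h1, h2⟩, h3⟩, h4⟩ := h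
  exact ⟨h1, h2, fun e he => h3 e he, h4⟩

/-- Rows of `L` (with default) are no longer than `f`. -/
theorem length_getRowN_le (p : PSDBlk) (h : ∀ r ∈ p.L, r.length ≤ p.f) (i : ℕ) :
    (getRowN p.L i).length ≤ p.f := by
  unfold getRowN
  rw [List.getD_eq_getElem?_getD]
  cases hi : p.L[i]? with
  | none => simp
  | some r => simpa using h r (List.mem_of_getElem? hi)

/-- The `L Lᵀ` entry as a sum over columns. -/
theorem LL_eq_sum (p : PSDBlk) (hBB : p.BB = p.B * p.B) (hlen : ∀ r ∈ p.L, r.length ≤ p.f) (i j : ℕ) :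
    dotNZ p.B p.BB (getRowN p.L i) (getRowN p.L j) 0 0 = ∑ c ∈ range p.f, p.ell i c * p.ell j c := by
  rw [dotNZ_eq_dotOffZ, hBB, dotOffZ_eq, dotAcc_eq]
  simp only [Nat.cast_zero, mul_zero, sub_zero, zero_add]
  rw [dotL_eq_sum _ _ p.f (by simpa [decRow] using length_getRowN_le p hlen i)
    (by simpa [decRow] using length_getRowN_le p hlen j)]
  rfl

/-- `deltaEnt` is symmetric. -/
theorem deltaEnt_symm (dl : List (ℕ × ℕ × ℤ)) (i j : ℕ) : deltaEnt dl i j = deltaEnt dl j i := by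
  unfold deltaEnt
  congr 1
  refine List.map_congr_left fun e _ => ?_
  by_cases h1 : e.1 = i ∧ e.2.1 = j <;> by_cases h2 : e.1 = j ∧ e.2.1 = i <;> simp [h1, h2]

/-- `deltaEnt` of a `cons`. -/
theorem deltaEnt_cons (e : ℕ × ℕ × ℤ) (dl : List (ℕ × ℕ × ℤ)) (i j : ℕ) :
    deltaEnt (e :: dl) i j =
      (if (e.1 = i ∧ e.2.1 = j) ∨ (e.1 = j ∧ e.2.1 = i) then e.2.2 else 0) + deltaEnt dl i j := by
  simp [deltaEnt]

/-- `deltaMass` of a `cons`. -/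
theorem deltaMass_cons (e : ℕ × ℕ × ℤ) (dl : List (ℕ × ℕ × ℤ)) :
    deltaMass (e :: dl) = (if e.1 = e.2.1 then 1 else 2) * e.2.2.natAbs + deltaMass dl := by
  simp [deltaMass]

/-- `S` is symmetric. -/
theorem Sent_symm (p : PSDBlk) (hp : psdOK p = true) (i j : ℕ) : Sent p i j = Sent p j i := by
  obtain ⟨hBB, hlen, -, -⟩ := psdOK_spec p hp
  unfold Sent
  rw [LL_eq_sum p hBB hlen, LL_eq_sum p hBB hlen, deltaEnt_symm]
  by_cases h : i = j
  · subst h; rfl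
  · rw [if_neg h, if_neg (Ne.symm h)]
    congr 2
    exact Finset.sum_congr rfl fun c _ => mul_comm _ _

/-! ### Nonnegative pairing with positive semidefinite kernels -/

/-- A double indicator sum. -/
theorem dsum_single (f a b : ℕ) (X : ℝ) (ha : a < f) (hb : b < f) :
    ∑ i ∈ range f, ∑ j ∈ range f, (if i = a then (if j = b then X else 0) else 0) = X := by
  have inner : ∀ i, ∑ j ∈ range f, (if i = a then (if j = b then X else 0) else 0) =
      if i = a then X else 0 := by
    intro i
    split_ifs with h
    · simp [Finset.sum_ite_eq', hb]
    · simp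
  rw [Finset.sum_congr rfl (fun i _ => inner i)]
  simp [Finset.sum_ite_eq', ha]

/-- One symmetric off-diagonal correction against a kernel: the indicator double sum. -/
theorem sum_offdiag_indicator (f : ℕ) (Φ : ℕ → ℕ → ℝ) (a b : ℕ) (v : ℤ) (ha : a < f) (hb : b < f)
    (hab : a ≠ b) :
    ∑ i ∈ range f, ∑ j ∈ range f,
      ((if (a = i ∧ b = j) ∨ (a = j ∧ b = i) then v else 0 : ℤ) : ℝ) * Φ i j =
        (v : ℝ) * Φ a b + (v : ℝ) * Φ b a := by
  have key : ∀ i j : ℕ, ((if (a = i ∧ b = j) ∨ (a = j ∧ b = i) then v else 0 : ℤ) : ℝ) * Φ i j =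
      (if i = a then (if j = b then (v : ℝ) * Φ a b else 0) else 0) +
      (if i = b then (if j = a then (v : ℝ) * Φ b a else 0) else 0) := by
    intro i j
    by_cases h1 : i = a <;> by_cases h2 : j = b <;> by_cases h3 : i = b <;> by_cases h4 : j = a <;>
      subst_vars <;> simp_all [eq_comm]
  simp_rw [key, Finset.sum_add_distrib]
  rw [dsum_single f a b _ ha hb, dsum_single f b a _ hb ha]

/-- One diagonal correction against a kernel. -/
theorem sum_diag_indicator (f : ℕ) (Φ : ℕ → ℕ → ℝ) (a : ℕ) (v : ℤ) (ha : a < f) :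
    ∑ i ∈ range f, ∑ j ∈ range f,
      ((if (a = i ∧ a = j) ∨ (a = j ∧ a = i) then v else 0 : ℤ) : ℝ) * Φ i j = (v : ℝ) * Φ a a := by
  have key : ∀ i j : ℕ, ((if (a = i ∧ a = j) ∨ (a = j ∧ a = i) then v else 0 : ℤ) : ℝ) * Φ i j =
      (if i = a then (if j = a then (v : ℝ) * Φ a a else 0) else 0) := by
    intro i j
    by_cases h1 : i = a <;> by_cases h2 : j = a <;> subst_vars <;> simp_all [eq_comm]
  simp_rw [key]
  exact dsum_single f a a _ ha ha

/-- The pairing of the correction with a kernel `Φ`, positive semidefinite on `{0,…,f-1}`, is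
bounded below by `-deltaMass · Σ_i Φ(i,i)`. -/
theorem delta_pairing_ge (f : ℕ) (Φ : ℕ → ℕ → ℝ) (hsym : ∀ i j, Φ i j = Φ j i)
    (hdiag : ∀ a, a < f → 0 ≤ Φ a a)
    (hoff : ∀ a b, a < f → b < f → a ≠ b → 2 * |Φ a b| ≤ Φ a a + Φ b b) :
    ∀ dl : List (ℕ × ℕ × ℤ), (∀ e ∈ dl, e.1 < f ∧ e.2.1 < f) →
      -((deltaMass dl : ℝ) * ∑ i ∈ range f, Φ i i) ≤
        ∑ i ∈ range f, ∑ j ∈ range f, (deltaEnt dl i j : ℝ) * Φ i j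
  | [], _ => by simp [deltaMass, deltaEnt]
  | (a, b, v) :: dl, h => by
    have hab : a < f ∧ b < f := h (a, b, v) (by simp)
    have ih := delta_pairing_ge f Φ hsym hdiag hoff dl fun e he => h e (by simp [he])
    have hsplit : ∑ i ∈ range f, ∑ j ∈ range f, (deltaEnt ((a, b, v) :: dl) i j : ℝ) * Φ i j =
        (∑ i ∈ range f, ∑ j ∈ range f,
          ((if (a = i ∧ b = j) ∨ (a = j ∧ b = i) then v else 0 : ℤ) : ℝ) * Φ i j) +
        ∑ i ∈ range f, ∑ j ∈ range f, (deltaEnt dl i j : ℝ) * Φ i j := by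
      rw [← Finset.sum_add_distrib]
      refine Finset.sum_congr rfl fun i _ => ?_
      rw [← Finset.sum_add_distrib]
      refine Finset.sum_congr rfl fun j _ => ?_
      rw [deltaEnt_cons]; push_cast; ring
    have htr : 0 ≤ ∑ i ∈ range f, Φ i i := Finset.sum_nonneg fun i hi => hdiag i (mem_range.1 hi)
    have hΦaa : Φ a a ≤ ∑ i ∈ range f, Φ i i :=
      Finset.single_le_sum (f := fun i => Φ i i) (fun i hi => hdiag i (mem_range.1 hi)) (mem_range.2 hab.1)
    have hΦbb : Φ b b ≤ ∑ i ∈ range f, Φ i i :=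
      Finset.single_le_sum (f := fun i => Φ i i) (fun i hi => hdiag i (mem_range.1 hi)) (mem_range.2 hab.2)
    have hcast : ((v.natAbs : ℕ) : ℝ) = |(v : ℝ)| := by
      rw [Nat.cast_natAbs, Int.cast_abs]
    rw [hsplit, deltaMass_cons]
    by_cases heq : a = b
    · subst heq
      rw [sum_diag_indicator f Φ a v hab.1]
      simp only [if_true, one_mul]
      push_cast
      rw [hcast]
      have hv : -|(v : ℝ)| * Φ a a ≤ (v : ℝ) * Φ a a := by
        nlinarith [neg_abs_le (v : ℝ), hdiag a hab.1, abs_nonneg (v : ℝ)]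
      nlinarith [hΦaa, abs_nonneg (v : ℝ), hdiag a hab.1]
    · rw [sum_offdiag_indicator f Φ a b v hab.1 hab.2 heq, hsym b a, if_neg heq]
      push_cast
      rw [hcast]
      have h2 := hoff a b hab.1 hab.2 heq
      have hprod : -(|(v : ℝ)| * |Φ a b|) ≤ (v : ℝ) * Φ a b := by
        rw [← abs_mul]; exact neg_abs_le _
      nlinarith [abs_nonneg (v : ℝ), abs_nonneg (Φ a b), hΦaa, hΦbb]


/-- A weighted double indicator sum against a kernel. -/
theorem dsum_delta (f : ℕ) (Φ : ℕ → ℕ → ℝ) (a b : ℕ) (ca cb : ℝ) (ha : a < f) (hb : b < f) :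
    ∑ i ∈ range f, ∑ j ∈ range f, (if i = a then ca else 0) * (if j = b then cb else 0) * Φ i j =
      ca * cb * Φ a b := by
  have key : ∀ i j : ℕ, (if i = a then ca else 0) * (if j = b then cb else 0) * Φ i j =
      (if i = a then (if j = b then ca * cb * Φ a b else 0) else 0) := by
    intro i j
    by_cases h1 : i = a <;> by_cases h2 : j = b <;> subst_vars <;> simp_all
  simp_rw [key]
  exact dsum_single f a b _ ha hb

/-- Diagonal values of a positive semidefinite kernel are nonnegative. -/
theorem kernel_diag_nonneg (f : ℕ) (Φ : ℕ → ℕ → ℝ)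
    (hpos : ∀ g : ℕ → ℝ, 0 ≤ ∑ i ∈ range f, ∑ j ∈ range f, g i * g j * Φ i j) (a : ℕ) (ha : a < f) :
    0 ≤ Φ a a := by
  have h := hpos fun i => if i = a then 1 else 0
  rw [dsum_delta f Φ a a 1 1 ha ha] at h
  simpa using h

/-- Off-diagonal values of a positive semidefinite kernel: `2|Φ(a,b)| ≤ Φ(a,a) + Φ(b,b)`. -/
theorem kernel_offdiag_le (f : ℕ) (Φ : ℕ → ℕ → ℝ) (hsym : ∀ i j, Φ i j = Φ j i)
    (hpos : ∀ g : ℕ → ℝ, 0 ≤ ∑ i ∈ range f, ∑ j ∈ range f, g i * g j * Φ i j) (a b : ℕ)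
    (ha : a < f) (hb : b < f) : 2 * |Φ a b| ≤ Φ a a + Φ b b := by
  have key : ∀ s : ℝ, 0 ≤ Φ a a + s * Φ a b + s * Φ b a + s * s * Φ b b := by
    intro s
    have h := hpos fun i => (if i = a then 1 else 0) + (if i = b then s else 0)
    have e : ∀ i j : ℕ, ((if i = a then (1 : ℝ) else 0) + (if i = b then s else 0)) *
        ((if j = a then (1 : ℝ) else 0) + (if j = b then s else 0)) * Φ i j =
        (if i = a then (1 : ℝ) else 0) * (if j = a then (1 : ℝ) else 0) * Φ i j +
        (if i = a then (1 : ℝ) else 0) * (if j = b then s else 0) * Φ i j +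
        (if i = b then s else 0) * (if j = a then (1 : ℝ) else 0) * Φ i j +
        (if i = b then s else 0) * (if j = b then s else 0) * Φ i j := by
      intro i j; ring
    simp_rw [e, Finset.sum_add_distrib] at h
    rw [dsum_delta f Φ a a 1 1 ha ha, dsum_delta f Φ a b 1 s ha hb, dsum_delta f Φ b a s 1 hb ha,
      dsum_delta f Φ b b s s hb hb] at h
    linarith
  rw [hsym b a] at key
  rcases le_or_gt 0 (Φ a b) with h | h
  · rw [abs_of_nonneg h]; have := key (-1); linarith
  · rw [abs_of_neg h]; have := key 1; linarith

/-- **Nonnegative pairing.** If `psdOK p` holds, `S = cμ I + L Lᵀ + Δ` pairs nonnegatively with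
every symmetric kernel `Φ` that is positive semidefinite on `{0,…,f-1}`. -/
theorem psd_pairing (p : PSDBlk) (hp : psdOK p = true) (Φ : ℕ → ℕ → ℝ) (hsym : ∀ i j, Φ i j = Φ j i)
    (hpos : ∀ g : ℕ → ℝ, 0 ≤ ∑ i ∈ range p.f, ∑ j ∈ range p.f, g i * g j * Φ i j) :
    0 ≤ ∑ i ∈ range p.f, ∑ j ∈ range p.f, (Sent p i j : ℝ) * Φ i j := by
  obtain ⟨hBB, hlen, hidx, hmass⟩ := psdOK_spec p hp
  have hS : ∀ i j, (Sent p i j : ℝ) * Φ i j = (if i = j then (p.cmu : ℝ) * Φ i j else 0) +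
      (∑ c ∈ range p.f, (p.ell i c : ℝ) * p.ell j c * Φ i j) + (deltaEnt p.delta i j : ℝ) * Φ i j := by
    intro i j
    unfold Sent
    rw [LL_eq_sum p hBB hlen]
    push_cast
    rw [add_mul, add_mul, Finset.sum_mul]
    split_ifs <;> ring
  simp_rw [hS, Finset.sum_add_distrib]
  -- the three pieces
  have hdiag := kernel_diag_nonneg p.f Φ hpos
  have h1 : ∑ i ∈ range p.f, ∑ j ∈ range p.f, (if i = j then (p.cmu : ℝ) * Φ i j else 0) =
      (p.cmu : ℝ) * ∑ i ∈ range p.f, Φ i i := by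
    rw [Finset.mul_sum]
    refine Finset.sum_congr rfl fun i hi => ?_
    rw [Finset.sum_ite_eq (range p.f) i, if_pos hi]
  have h2 : 0 ≤ ∑ i ∈ range p.f, ∑ j ∈ range p.f, ∑ c ∈ range p.f, (p.ell i c : ℝ) * p.ell j c * Φ i j := by
    rw [Finset.sum_comm]
    have e : ∀ j ∈ range p.f, ∑ i ∈ range p.f, ∑ c ∈ range p.f, (p.ell i c : ℝ) * p.ell j c * Φ i j =
        ∑ c ∈ range p.f, ∑ i ∈ range p.f, (p.ell i c : ℝ) * p.ell j c * Φ i j := fun j _ => Finset.sum_comm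
    rw [Finset.sum_congr rfl e, Finset.sum_comm]
    refine Finset.sum_nonneg fun c _ => ?_
    have h := hpos fun i => (p.ell i c : ℝ)
    rw [Finset.sum_comm] at h
    simpa using h
  have h3 := delta_pairing_ge p.f Φ hsym hdiag (fun a b ha hb _ => kernel_offdiag_le p.f Φ hsym hpos a b ha hb)
    p.delta hidx
  have htr : 0 ≤ ∑ i ∈ range p.f, Φ i i := Finset.sum_nonneg fun i hi => hdiag i (mem_range.1 hi)
  have hm : (deltaMass p.delta : ℝ) ≤ p.cmu := by exact_mod_cast hmass
  rw [h1]
  nlinarith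

end Summit.Ventures.PackingBounds.ThreePointCert

end
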